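import Literature.NumberTheory.EllipticCurves.KatoAdditiveTwistedValueNeronIntegralityThree
import Literature.NumberTheory.EllipticCurves.GaussianLatticeHeckeLValue
import Summits.BirchSwinnertonDyer.BirchSwinnertonDyer.Theorems.InertBadSignedBranchesInertBadAtThreeManinOfKatoThree
import HarnessLib

/-!
# Sketch (crux idea `rubin-e1-inert-three`, ideator bsd-idea-18 g6, lens = transfer) for crux `InertBadAtThree`
# (stmt-BirchSwinnertonDyer-19225), line of record `bed_at_three` v5, stub `stub_katoFactThreePolar`

Nothing here proves BSD, the crux, the stub, or F-es-18. This file TYPES the transfer target of the idea and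
KERNEL-CHECKS the reduction layer over existing declarations:

* `NeronIntegralThreePolarAt V` — F-es-18 (`kato_neron_isIntegral_twistedSymbolSum_of_additive_three_polar`)
  with the curve `V` FIXED (pointwise form; `katoFact_iff_forall` : the named fact is `∀ V, NeronIntegralThreePolarAt V`).
* `NeronIntegralThreeCMInert` (C⁺, the transfer target): the pointwise statement on the class the line actually
  consumes — globally minimal CM curves with `3` inert in the CM field and bad at `3` (all such have `h_K = 1`,
  `K ∈ {ℚ(i), ℚ(√−7), ℚ(√−19), ℚ(√−43), ℚ(√−67), ℚ(√−163)}`; bad ⟹ twisted at 3: the quartic cell `j = 1728`,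
  Kodaira III/III*, and the quadratic `I₀*` cell); `NeronIntegralThreeQuartic` its `j = 1728` sub-cell.
* `PointwiseKatoShiftLever` (support S1): route ManinLocalTwoThree's lever `katoShiftTwistManinThree_of_katoFact`
  with the GLOBAL named fact replaced by the pointwise hypothesis at the curve in hand (the tree proof applies the
  fact exactly once, at `V = W`: `…KatoShiftLever.pint_charSum_div_three'` l. 173) — a mechanical refactor.
* `maninAtThree_of_pointwiseLever_of_cmFact` / `maninAtThreeQuartic_of_pointwiseLever_of_cmFact` (no sorry):
  S1 ∧ C⁺ ⟹ the line's Manin statements at 3 (bodies VERBATIM = `maninAtThree_of_katoFactThreePolar` /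
  `maninAtThreeQuartic_of_katoFactThreePolar` of p620851), i.e. C⁺ replaces F-es-18 in `bed_at_three` v5.
The CM-side road to C⁺ (Rubin 1983 / Stevens 1989 (6.8)–(6.9) transferred from a ramified `p > 3` to the inert
`p = 3`; finite Eisenstein–Kronecker formula `GaussianLattice.thetaLFunction_one_eq_sum_kroneckerE₁`, PROVED in the
tree for `K = ℚ(i)`) is described in the idea card `Cruxes/InertBadAtThree/Ideas/rubin-e1-inert-three.md`.
-/

set_option autoImplicit false
set_option linter.dupNamespace false

noncomputable section

open scoped MatrixGroups ModularForm Classical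

open CongruenceSubgroup WeierstrassCurve
  Literature.NumberTheory.EllipticCurves Literature.NumberTheory.EllipticCurves.Rank1Residual
  Literature.NumberTheory.EllipticCurves.ModularForms

namespace Summit.BirchSwinnertonDyer.BirchSwinnertonDyer.Cruxes.InertBadAtThree.RubinE1InertThree

open Summit.BirchSwinnertonDyer.Rank1Residual
open Summit.BirchSwinnertonDyer.BirchSwinnertonDyer.Theorems.InertBadSignedBranchesInertBadAtThreeManinOfKatoThree
  (nine_dvd_conductorNorm_of_hasCM_of_not_good)

/-- F-es-18 with the curve FIXED: for THIS globally minimal `V`, additive at `3` with `V[3]` irreducible, every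
primitive `χ` mod `m`, `(m, 3N) = 1`, `χ ≠ 1`, `3 ∤ ord χ`, `χ(3) ∉ {1, −1}`: the symmetrised Birch–Manin twisted value
is `3`-integral against the NÉRON periods of `V` (body VERBATIM after the `V` binders of
`kato_neron_isIntegral_twistedSymbolSum_of_additive_three_polar`). -/
@[conjecture] def NeronIntegralThreePolarAt (V : WeierstrassCurve ℚ) [V.IsElliptic] [V.IsGloballyMinimal] : Prop :=
  ∀ {N : ℕ} [NeZero N]
    (f : CuspForm (Gamma0 N) 2) (_ : IsNewformOf V f)
    (_ : ¬ V.HasGoodReductionAtPrime 3) (_ : ¬ V.HasMultiplicativeReductionAtPrime 3)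
    (_ : V.HasIrreducibleModPGaloisRep 3) (m : ℕ) [NeZero m] (_ : m.Coprime (3 * N))
    (χ : DirichletCharacter ℂ m) (_ : χ.IsPrimitive) (_ : χ ≠ 1) (_ : ¬ 3 ∣ orderOf χ)
    (_ : χ (3 : ZMod m) ≠ 1) (_ : χ (3 : ZMod m) ≠ -1) (ϖ : ℚ) (r : ℂ),
    (χ.Even → (ϖ : ℝ) * V.realPeriodRat = plusPeriod f →
      (∏ ℓ ∈ N.primeFactors with ¬ ℓ ^ 2 ∣ N,
          (((ℓ : ℂ) - (V.LFunction ℓ : ℂ) * χ (ℓ : ZMod m)) *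
            ((ℓ : ℂ) - (V.LFunction ℓ : ℂ) * (χ (ℓ : ZMod m))⁻¹))) *
          twistedSymbolSum f χ = r * (plusPeriod f : ℂ) →
      ∃ s : ℕ, ¬ 3 ∣ s ∧ IsIntegral ℤ ((s : ℂ) * ϖ * r)) ∧
    (χ.Odd → (ϖ : ℝ) * V.imaginaryPeriodRat = minusPeriod f →
      (∏ ℓ ∈ N.primeFactors with ¬ ℓ ^ 2 ∣ N,
          (((ℓ : ℂ) - (V.LFunction ℓ : ℂ) * χ (ℓ : ZMod m)) *
            ((ℓ : ℂ) - (V.LFunction ℓ : ℂ) * (χ (ℓ : ZMod m))⁻¹))) *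
          twistedSymbolSum f χ = r * (minusPeriod f : ℂ) * Complex.I →
      ∃ s : ℕ, ¬ 3 ∣ s ∧ IsIntegral ℤ ((s : ℂ) * ϖ * r))

/-- The named fact F-es-18 IS the conjunction of its pointwise instances (definitional). -/
theorem katoFact_iff_forall :
    kato_neron_isIntegral_twistedSymbolSum_of_additive_three_polar ↔
      ∀ (V : WeierstrassCurve ℚ) [V.IsElliptic] [V.IsGloballyMinimal], NeronIntegralThreePolarAt V :=
  Iff.rfl

/-- **C⁺ (transfer target of the idea).** F-es-18's conclusion on exactly the class line `bed_at_three` consumes: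
globally minimal CM curves with `3` inert in the CM field and bad (hence additive) at `3`. To be proved on the CM
side (Hecke `L`-values of the class-number-one CM field, Eisenstein–Kronecker numbers at division points of order
divisible by the inert `3`; card `rubin-e1-inert-three`), not from Kato's Euler system. -/
@[conjecture] def NeronIntegralThreeCMInert : Prop :=
  ∀ (V : WeierstrassCurve ℚ) [V.IsElliptic] [V.IsGloballyMinimal],
    V.HasCM → CMInert V 3 → ¬ Good V 3 → NeronIntegralThreePolarAt V

/-- **C⁺ on the quartic sub-cell** `j = 1728` (CM by `ℤ[i]`; bad at `3` = the quartic twists `y² = x³ − Dx`, `3 ∣ D`,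
Kodaira III / III* / I₀* at `3`), where the tree's PROVED finite formula
`GaussianLattice.thetaLFunction_one_eq_sum_kroneckerE₁` (Rubin LNM 1716 Prop. 7.15 at `k = 1`, `K = ℚ(i)`) applies. -/
@[conjecture] def NeronIntegralThreeQuartic : Prop :=
  ∀ (V : WeierstrassCurve ℚ) [V.IsElliptic] [V.IsGloballyMinimal],
    V.j = 1728 → ¬ V.HasGoodReductionAtPrime 3 → NeronIntegralThreePolarAt V

/-- **Support S1: the POINTWISE Kato shift lever** — `Rank1Residual.ManinAdditive.KatoShiftTwistManinThree` with the
pointwise Néron-integrality of THE curve `W` as an extra hypothesis (refactor of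
`Theorems.ManinLocalTwoThree.katoShiftTwistManinThree_of_katoFact`, whose proof uses the global fact only at `V = W`,
`…KatoShiftLever.pint_charSum_div_three'`; generation input = tree theorem `shiftClassGenerationThree_holds`). -/
@[conjecture] def PointwiseKatoShiftLever : Prop :=
  ∀ (W : WeierstrassCurve ℚ) [W.IsElliptic] [W.IsGloballyMinimal] {N : ℕ} [NeZero N]
    (D : ModularParametrizationData W N),
    NeronIntegralThreePolarAt W →
    (∀ z ∈ D.L.lattice, ∃ w ∈ periodLattice D.f, z = D.c * w) → 3 ^ 2 ∣ N →
    W.HasIrreducibleModPGaloisRep 3 → ¬ (3 : ℤ) ∣ D.c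

/-- S1 is implied by the global fact (sanity: the pointwise lever is not stronger than what the tree already derives
from F-es-18 — given F-es-18 its extra hypothesis is free). -/
theorem pointwiseKatoShiftLever_of_katoFact
    (hK : kato_neron_isIntegral_twistedSymbolSum_of_additive_three_polar) : PointwiseKatoShiftLever := by
  intro W _ _ N _ D _ hopt h9 hirr
  exact Summit.BirchSwinnertonDyer.BirchSwinnertonDyer.Theorems.ManinLocalTwoThree.katoShiftTwistManinThree_of_katoFact
    hK W D hopt h9 hirr

/-- **`3 ∤ c(D)` per curve from S1 ∧ C⁺** (cf. `not_three_dvd_c_of_katoFactThreePolar_of_cmInert`, with F-es-18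
replaced by its CM-inert instances). -/
theorem not_three_dvd_c_of_pointwiseLever_of_cmFact (hL : PointwiseKatoShiftLever) (hC : NeronIntegralThreeCMInert)
    (W : WeierstrassCurve ℚ) [W.IsElliptic] [W.IsGloballyMinimal] [NeZero (W.conductorNorm ℤ)]
    (D : ModularParametrizationData W (W.conductorNorm ℤ))
    (hopt : ∀ z ∈ D.L.lattice, ∃ w ∈ periodLattice D.f, z = D.c * w)
    (hCM : W.HasCM) (hin : CMInert W 3) (hbad : ¬ Good W 3) : ¬ (3 : ℤ) ∣ D.c :=
  hL W D (hC W hCM hin hbad) hopt (nine_dvd_conductorNorm_of_hasCM_of_not_good W hCM hbad)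
    (X12.irr_of_cmInert W 3 (by norm_num) hin)

/-- **Line `bed_at_three`'s Manin input `ManinAtThree` (body VERBATIM = `maninAtThree_of_katoFactThreePolar`) from
S1 ∧ C⁺** — no Kato fact, no Kodaira split. -/
theorem maninAtThree_of_pointwiseLever_of_cmFact (hL : PointwiseKatoShiftLever) (hC : NeronIntegralThreeCMInert) :
    ∀ (W : WeierstrassCurve ℚ) [W.IsElliptic] [W.IsGloballyMinimal] [NeZero (W.conductorNorm ℤ)]
      (p : ℕ) [Fact p.Prime]
      (D : Literature.NumberTheory.EllipticCurves.ModularForms.ModularParametrizationData W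
        (W.conductorNorm ℤ)),
      W.HasCM → W.analyticRank = 1 → p = 3 →
      Literature.NumberTheory.EllipticCurves.Rank1Residual.CMInert W p →
      ¬ Literature.NumberTheory.EllipticCurves.Rank1Residual.Good W p →
      (∀ z ∈ D.L.lattice, ∃ w ∈ Literature.NumberTheory.EllipticCurves.ModularForms.periodLattice D.f,
        z = D.c * w) → ¬ (p : ℤ) ∣ D.c := by
  intro W _ _ _ p _ D hCM _ h3 hin hbad hopt
  subst h3
  exact not_three_dvd_c_of_pointwiseLever_of_cmFact hL hC W D hopt hCM hin hbad

/-- **The registered v3 stub statement `ManinAtThreeQuartic` (body VERBATIM = `maninAtThreeQuartic_of_katoFactThreePolar`)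
from S1 ∧ C⁺.** -/
theorem maninAtThreeQuartic_of_pointwiseLever_of_cmFact (hL : PointwiseKatoShiftLever)
    (hC : NeronIntegralThreeCMInert) :
    ∀ (W : WeierstrassCurve ℚ) [W.IsElliptic] [W.IsGloballyMinimal] [NeZero (W.conductorNorm ℤ)] (p : ℕ)
      [Fact p.Prime] (D : Literature.NumberTheory.EllipticCurves.ModularForms.ModularParametrizationData W
        (W.conductorNorm ℤ)) (v : IsDedekindDomain.HeightOneSpectrum ℤ),
      Rat.HeightOneSpectrum.natGenerator v = p → W.HasCM → W.analyticRank = 1 → p = 3 →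
      Literature.NumberTheory.EllipticCurves.Rank1Residual.CMInert W p →
      ¬ Literature.NumberTheory.EllipticCurves.Rank1Residual.Good W p →
      (∀ z ∈ D.L.lattice, ∃ w ∈ Literature.NumberTheory.EllipticCurves.ModularForms.periodLattice D.f,
        z = D.c * w) →
      (W.j = 1728 ∧ (W.kodairaSymbolAt v = Literature.NumberTheory.DiophantineGeometry.KodairaSymbol.III ∨
        W.kodairaSymbolAt v = Literature.NumberTheory.DiophantineGeometry.KodairaSymbol.IIIstar)) →
      ¬ (p : ℤ) ∣ D.c := by
  intro W _ _ _ p _ D v _ hCM hr h3 hin hbad hopt _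
  exact maninAtThree_of_pointwiseLever_of_cmFact hL hC W p D hCM hr h3 hin hbad hopt

/-! ## The CM-side engine already in the tree (`K = ℚ(i)`): the finite Eisenstein–Kronecker formula -/

#check @Literature.NumberTheory.EllipticCurves.GaussianLattice.thetaLFunction_one_eq_sum_kroneckerE₁

end Summit.BirchSwinnertonDyer.BirchSwinnertonDyer.Cruxes.InertBadAtThree.RubinE1InertThree

end
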